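import Summits.QuantumFields.YangMills.Theorems.BalabanUVNodesN11TransportOfRecordInPrivateCoordinateChart
import Summits.QuantumFields.YangMills.Theorems.BalabanUVNodesN11TStepInFibreChart

/-!
# DAG node N11 — def-T's (†) `tstepOfRecord` FOR ALL NEW SEQUENCES AT ONCE, the represented tower's pre-𝐑 slots, the 𝐓-image clause and THE FIRST STEP,
# IN THE PRIVATE-COORDINATE CHART AT THE RECORD (the kernel-level socket instantiated at dag-n11-w6's socket discharge; per-bond inversion data displayed)

HEADER — WORK-UNIT METADATA.  Cell `pub-ymgap`, YM-PLAN Track A (HUMAN RULING D-0062), seat `pub-ymgap-dag-n08-w2` (g8; WIDTH SEAT 2∕4 on N08 [B10],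
RE-POINTED to N11's [III] §3-supply residue), route `BalabanUVNodes` rev 27, key item K1⁷ `StabilityBAtRecordR13SepCoPH` = stmt-QuantumFields-20542 (helper lane,
`--kind proof --supports 20542 --as helper`, count-neutral; K1⁷ is `aside` behind K1⁸ stmt-QuantumFields-26907 — (B4)-socket bookkeeping, not a K1-face file).
[I] = [Balaban1987RG1], [III] = [Balaban1988Convergent].  FILE 7 of this seat's kernel-level socket = my g7 trigger (t10) «a chart seat lands a socket at the record»
FIRED by dag-n11-w6 g2's `…N11TransportOfRecordInPrivateCoordinateChart` (p620673 ✓: `hpush_privateChart`, `hfib_privateChart`, `measurable_privateChart`,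
`measurable_privateJacobian`, over dag-n09-w6 g3's `T4TriangularFibredChart` p616307 ✓).  Consumed BY NAME with my FILE 1 `…N11CondLawInFibreChart` (p611747 ✓:
`chart_of_map_eq_restrict`) and FILE 2 `…N11TStepInFibreChart` (p613290 → p618553 ✓: `ae_forall_transportOfRecord_eq_chart`, `ae_forall_tstepOfRecord_eq_chart`,
`ae_forall_slotsTOfRecord₁₃H_succ_eq_chart`, `tImageClause_iff_chart`, `ae_forall_slotsTOfRecord₁₃H_one_eq_chart`, `firstStepIntegralIdentityAt_iff_chart`).

WHY THIS FILE.  dag-n11-w6 g2 discharged dag-n11-d's PER-DENSITY socket (`hpush ∧ hfib`, fixed charted set) at the record `(dU, dV) = (fieldMeasure k, fieldMeasure (k+1))`,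
`avg = avOfRecord F N K k`, in the PRIVATE COORDINATES: resample the central crossing bond `β(c)` of every coarse bond `c` by a local inverse `ϑ_c(U, ·)` of the (0.4) one-variable
fibre map, with inverse change-of-variables law `Haar⌊Ω_c(U) = ϑ_c(U,·)_*(j_c(U,·) · Haar⌊T_c(U))` — data `(Ω, T, ϑ, j)` DISPLAYED (their CLAIM-2 ∕ dag-n09-w6's (F)∕(S) own it) —,
fibre reference `dU` itself (constant kernel), chart `Ψ(V,U) = extend β (c ↦ ϑ_c(U, V c)) U`, Jacobian `J(V,U) = 𝟙[∀ c, V c ∈ T_c(U)]·∏_c j_c(U, V c)`, charted set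
`S = {U | ∀ c, U(β c) ∈ Ω_c(U)}`.  FILE 1 §1 turns `hpush ∧ hfib` into the KERNEL-LEVEL `hchart` on the window `Prod.snd ⁻¹' S` (§1 here), after which FILE 2 gives — with the
null set UNIFORM in the density, hence for def-T's `V′`-DEPENDENT integrands — (§2) `transportOfRecord F N K k ρ V = ∫ dU J(V,U)·ρ(Ψ(V,U))` for a.e. `V` and EVERY measurable
`ρ` with the support clause (no integrability asked; n11-w6's ★★★ is the per-`ρ`, integrable edition); (§3) def-T's (†) `tstepOfRecord … s′ V′` for ALL new sequences `s′` at
once and the represented tower's pre-𝐑 slots `slotsTOfRecord … (k+1) s V′` (Stage-13 letters) as honest `dU`-integrals over resampled central bonds, plus the 𝐓-image clause of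
(O3′) ∕ `NoExpansionClauseFor` in that currency — the displayed SUPPORT CLAUSE «`w_k(s)(U, V′) ≠ 0 ⇒ ∀ c, U(β c) ∈ Ω_c(U)`» says the resummed small-field restrictions
(3.2)–(3.5) keep the private coordinates inside their inversion windows; (§4) at `k = 0 < K`: the pre-𝐑 slots of `𝐓ρ₀` and my g0 `FirstStepIntegralIdentityAt θ p` ⟺ its
private-coordinate form — [I] Thm 1's `𝐓ρ₀ = 𝐓₁ exp A₁` with the δ-functions removed by SOLVING `Ū′(c) = V′(c)` for the central bond variables.

WHAT THIS FILE PROVES (0 `def`, 0 `sorry`, standard axioms; all BY NAME over p620673 + FILE 1 + FILE 2).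
§1 `measurableSet_privateDomain` · ★ `chart_privateChart` (FILE 1's `hchart` AT THE RECORD, inhabited by a non-tautological chart).
§2 ★★ `ae_forall_transportOfRecord_eq_privateChart`.
§3 ★★★ `ae_forall_tstepOfRecord_eq_privateChart` · ★★ `ae_forall_slotsTOfRecord₁₃H_succ_eq_privateChart` · ★★ `tImageClause_iff_privateChart`.
§4 ★★ `ae_forall_slotsTOfRecord₁₃H_one_eq_privateChart` · ★★★ `firstStepIntegralIdentityAt_iff_privateChart`.

HONEST FRAMING.  Helper lane of K1⁷ (aside); count-neutral; by-name instantiations (measure-theoretic bookkeeping); the per-bond inversion data `(Ω, T, ϑ, j; hΩm hTm hθm hjm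
hΩbl hright hlaw)` and the step weights' support clause are HYPOTHESES, displayed exactly as in p620673 — nothing inverted or estimated here; the private-coordinate chart is a
VALID chart of the disintegration, NOT Bałaban's exp ∕ (47) ∕ `C` chart of [III] (3.10)–(3.15) (dag-n11-e g22's caveat: the Gaussian form (3.23) appears only after the latter);
nothing of Bałaban ([I] §2, [III] §3, Thm 1–2) is asserted; the predicates of §4 are NOT claimed inhabited for any `θ`; (B4)∕(S-α)∕(O3′) NOT closed; N11 NOT discharged; N08
untouched; K1⁷∕K1⁸ NOT closed, no registered stub touched; counts unmoved (typed 28∕28 · discharged 5∕27 · A 5∕28).  One finite `𝕋⁴_{L^K}` programme at fixed `ε = L^{−K}`;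
R4 closes only the conditional finite-𝕋⁴ rung `BalabanLadder.UV` — NOT ℝ⁴, NOT OS, NOT a mass gap, NOT Clay.  No `sorry`, `axiom`, `def`, `instance`, `notation`.
Sources (SHAPE ∕ bookkeeping only): [I] (0.4) p.253, Thm 1 p.259, (0.24)–(0.27) p.257, (2.4) p.266, (2.9)–(2.10) p.267; [III] Thm 1 p.262, (3.1) p.264, (3.2)–(3.5) p.265,
p.267 L18–24, (3.24)–(3.25) p.270, §3 p.279.
-/

noncomputable section

open MeasureTheory ProbabilityTheory Set Function
open scoped ENNReal NNReal

namespace Summit.QuantumFields.YangMills.Theorems.BalabanUVNodesN11TStepInPrivateCoordinateChart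

open Literature.MathematicalPhysics.QuantumFieldTheory.Balaban1983to89
open Literature.MathematicalPhysics.QuantumFieldTheory.Balaban1983to89.T4AveragingDisintegration
open Literature.MathematicalPhysics.QuantumFieldTheory.Balaban1983to89.T4TriangularFibredChart
open Literature.MathematicalPhysics.QuantumFieldTheory.Balaban1983to89.BlockAveragingHaarAC (centralBond centralBond_injective isLocal_avgFun)
open Literature.MathematicalPhysics.QuantumFieldTheory.Balaban1983to89.ExpMeanLog (expMeanLogSU)
open BalabanUVNodesN11CondLawInFibreChart BalabanUVNodesN11TStepInFibreChart BalabanUVNodesN11TransportOfRecordInPrivateCoordinateChart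

section Record

open Node00 hiding SU
open T4Continuum

variable {F : T4Family} {N : ℕ} [NeZero N] {K k : ℕ}
  (Ω T : PBond (F.P K) (k + 1) → GaugeField (F.P K) k (SU N) → Set (SU N))
  (ϑ : PBond (F.P K) (k + 1) → GaugeField (F.P K) k (SU N) → SU N → SU N)
  (jd : PBond (F.P K) (k + 1) → GaugeField (F.P K) k (SU N) → SU N → ℝ≥0)

/-! ## §1  The kernel-level socket `hchart` AT THE RECORD, inhabited by the private-coordinate chart (modulo per-bond inversion data) -/

omit [NeZero N] in
/-- The charted set of the private-coordinate chart, `{U | ∀ c, U(β c) ∈ Ω_c(U)}`, is measurable (p616307 `measurableSet_fineDomain`).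
[cite: Balaban1987RG1, (2.9) p.267 (bookkeeping: the small-field windows of the private coordinates)] -/
theorem measurableSet_privateDomain
    (hΩm : ∀ c, MeasurableSet {p : GaugeField (F.P K) k (SU N) × SU N | p.2 ∈ Ω c p.1}) :
    MeasurableSet {U : GaugeField (F.P K) k (SU N) | ∀ c, U (centralBond c) ∈ Ω c U} :=
  measurableSet_fineDomain (ι := PBond (F.P K) k) (κ := PBond (F.P K) (k + 1)) (G := SU N) (β := centralBond) Ω hΩm

/-- **★ FILE 1's `hchart` AT THE RECORD, INHABITED BY THE PRIVATE-COORDINATE CHART**: for `k < K` and per-bond inversion data `(Ω, T, ϑ, j)` of the (0.4) one-variable fibre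
maps of `avOfRecord F N K k` (dag-n11-w6 g2's `hpush_privateChart` ∧ `hfib_privateChart`, p620673, over dag-n09-w6's p616307), the constant fibre kernel `Kernel.const _ dU`, the
resampling chart `Ψ(V,U) = extend β (c ↦ ϑ_c(U, V c)) U`, the Jacobian `J(V,U) = 𝟙[∀ c, V c ∈ T_c(U)]·∏_c j_c(U, V c)` and the window `Prod.snd ⁻¹' {U | ∀ c, U(β c) ∈ Ω_c(U)}` form a
fibre chart of the JOINT LAW of `(Ū, U)` under `dU = fieldMeasure k` with respect to `dV = fieldMeasure (k+1)` (FILE 1 `chart_of_map_eq_restrict`).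
[cite: Balaban1987RG1, (0.4) p.253, (2.4) p.266, (2.10) p.267; Balaban1988Convergent, (3.1) p.264, p.267 L18–24] -/
theorem chart_privateChart [DecidableEq (PBond (F.P K) k)] (hk : k < K)
    (hΩm : ∀ c, MeasurableSet {p : GaugeField (F.P K) k (SU N) × SU N | p.2 ∈ Ω c p.1})
    (hTm : ∀ c, MeasurableSet {p : GaugeField (F.P K) k (SU N) × SU N | p.2 ∈ T c p.1})
    (hθm : ∀ c, Measurable fun p : GaugeField (F.P K) k (SU N) × SU N => ϑ c p.1 p.2)
    (hjm : ∀ c, Measurable fun p : GaugeField (F.P K) k (SU N) × SU N => jd c p.1 p.2)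
    (hΩbl : ∀ c (U : GaugeField (F.P K) k (SU N)) (g : PBond (F.P K) (k + 1) → SU N), Ω c (extend centralBond g U) = Ω c U)
    (hright : ∀ c U, ∀ v ∈ T c U, (avOfRecord F N K k).avg (update U (centralBond c) (ϑ c U v)) c = v)
    (hlaw : ∀ c U, (HaarData.haar : Measure (SU N)).restrict (Ω c U) =
      (((HaarData.haar : Measure (SU N)).restrict (T c U)).withDensity fun v => (jd c U v : ℝ≥0∞)).map (ϑ c U)) :
    (((fieldMeasure (F.P K) (k + 1) (SU N)) ⊗ₘ
        (Kernel.const (GaugeField (F.P K) (k + 1) (SU N)) (fieldMeasure (F.P K) k (SU N)))).withDensity (fun z =>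
          (({p : GaugeField (F.P K) (k + 1) (SU N) × GaugeField (F.P K) k (SU N) | ∀ c, p.1 c ∈ T c p.2}.indicator
            (fun p => ∏ c, jd c p.2 (p.1 c)) z : ℝ≥0) : ℝ≥0∞))).map
        (fun z => (z.1, (extend centralBond (fun c => ϑ c z.2 (z.1 c)) z.2 : GaugeField (F.P K) k (SU N)))) =
      (jointLaw (fieldMeasure (F.P K) k (SU N)) (avOfRecord F N K k).avg).restrict
        (Prod.snd ⁻¹' {U : GaugeField (F.P K) k (SU N) | ∀ c, U (centralBond c) ∈ Ω c U}) :=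
  chart_of_map_eq_restrict (avOfRecord_measurable F N K k) (measurable_privateChart ϑ hk hθm) (measurableSet_privateDomain Ω hΩm)
    (hpush_privateChart Ω T ϑ jd hk hΩm hTm hθm hjm hΩbl hright hlaw) (hfib_privateChart T ϑ jd hk hTm hjm hright _)

/-! ## §2  def-T's one-step transport of record in the private-coordinate chart, EVERY DENSITY AT ONCE (no integrability asked) -/

/-- **★★ `transportOfRecord` IN THE PRIVATE-COORDINATE CHART, EVERY DENSITY AT ONCE**: for `dV`-a.e. `V` and EVERY measurable density `ρ` with the SUPPORT CLAUSE «`ρ U ≠ 0 ⇒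
∀ c, U(β c) ∈ Ω_c(U)`», `transportOfRecord F N K k ρ V = ∫ dU 𝟙[∀ c, V c ∈ T_c(U)]·∏_c j_c(U, V c) · ρ(extend β (ϑ_c(U, V c))_c U)` — dag-n11-w6's ★★★
`transportOfRecord_ae_eq_integral_privateChart_of_support` (ONE integrable `ρ`, `=ᵐ`) with the null set UNIFORM IN `ρ` and no integrability hypothesis (FILE 2 ★★
`ae_forall_transportOfRecord_eq_chart` at §1). [cite: Balaban1988Convergent, (3.1) p.264, p.267 L18–24; Balaban1987RG1, (0.4) p.253, (2.10) p.267] -/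
theorem ae_forall_transportOfRecord_eq_privateChart [DecidableEq (PBond (F.P K) k)] (hk : k < K)
    (hΩm : ∀ c, MeasurableSet {p : GaugeField (F.P K) k (SU N) × SU N | p.2 ∈ Ω c p.1})
    (hTm : ∀ c, MeasurableSet {p : GaugeField (F.P K) k (SU N) × SU N | p.2 ∈ T c p.1})
    (hθm : ∀ c, Measurable fun p : GaugeField (F.P K) k (SU N) × SU N => ϑ c p.1 p.2)
    (hjm : ∀ c, Measurable fun p : GaugeField (F.P K) k (SU N) × SU N => jd c p.1 p.2)
    (hΩbl : ∀ c (U : GaugeField (F.P K) k (SU N)) (g : PBond (F.P K) (k + 1) → SU N), Ω c (extend centralBond g U) = Ω c U)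
    (hright : ∀ c U, ∀ v ∈ T c U, (avOfRecord F N K k).avg (update U (centralBond c) (ϑ c U v)) c = v)
    (hlaw : ∀ c U, (HaarData.haar : Measure (SU N)).restrict (Ω c U) =
      (((HaarData.haar : Measure (SU N)).restrict (T c U)).withDensity fun v => (jd c U v : ℝ≥0∞)).map (ϑ c U)) :
    ∀ᵐ V ∂(fieldMeasure (F.P K) (k + 1) (SU N)), ∀ ρ : Density (F.P K) k (SU N), Measurable ρ → (∀ U, ρ U ≠ 0 → ∀ c, U (centralBond c) ∈ Ω c U) →
      transportOfRecord F N K k ρ V = ∫ U,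
        (({p : GaugeField (F.P K) (k + 1) (SU N) × GaugeField (F.P K) k (SU N) | ∀ c, p.1 c ∈ T c p.2}.indicator
            (fun p => ∏ c, jd c p.2 (p.1 c)) (V, U) : ℝ≥0) : ℝ) *
          ρ (extend centralBond (fun c => ϑ c U (V c)) U : GaugeField (F.P K) k (SU N)) ∂(fieldMeasure (F.P K) k (SU N)) := by
  filter_upwards [ae_forall_transportOfRecord_eq_chart (F := F) (N := N) hk (measurable_privateChart ϑ hk hθm) (measurable_privateJacobian T jd hTm hjm)
    ((measurableSet_privateDomain Ω hΩm).preimage measurable_snd) (chart_privateChart Ω T ϑ jd hk hΩm hTm hθm hjm hΩbl hright hlaw)] with V hV ρ hρ hS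
  rw [hV ρ hρ (fun U hU => by
    by_contra h
    exact hU (hS U h))]
  rfl

end Record

/-! ## §3  def-T's (†) `tstepOfRecord` FOR ALL NEW SEQUENCES AT ONCE and the represented tower's pre-𝐑 slots, in the private-coordinate chart -/

section TStep

open Node00 hiding SU
open T4Continuum

variable {F : T4Family} {N : ℕ} [NeZero N] (p : B12.RunParams) {k : ℕ}
  (Ω T : PBond (F.P p.K) (k + 1) → GaugeField (F.P p.K) k (SU N) → Set (SU N))
  (ϑ : PBond (F.P p.K) (k + 1) → GaugeField (F.P p.K) k (SU N) → SU N → SU N)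
  (jd : PBond (F.P p.K) (k + 1) → GaugeField (F.P p.K) k (SU N) → SU N → ℝ≥0)

/-- **★★★ def-T's VALUE-LEVEL T-STEP (†) IN THE PRIVATE-COORDINATE CHART, FOR ALL NEW SEQUENCES AT ONCE**: for `k < K`, per-bond inversion data `(Ω, T, ϑ, j)`, step weights
with measurable `U`-sections and the SUPPORT CLAUSE «`w(s′)(U, V′) ≠ 0 ⇒ ∀ c, U(β c) ∈ Ω_c(U)`» (the resummed small-field restrictions (3.2)–(3.5) keep the private coordinates
in their windows — DISPLAYED), measurable `χ_k(s)` and `T(s)`: for `dV′`-a.e. `V′` and EVERY new sequence `s′`,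
`(𝐓e^A)_{k+1}(s′)(V′) = ∫ dU 𝟙[∀ c, V′ c ∈ T_c(U)]·∏_c j_c(U, V′ c) · (w(s′)(·, V′) · χ_k(init s′) · T(init s′))(extend β (ϑ_c(U, V′ c))_c U)` — FILE 2 ★★
`ae_forall_tstepOfRecord_eq_chart` at §1's chart. [cite: Balaban1988Convergent, (3.1) p.264, (3.2)–(3.5) p.265, p.267 L18–24; Balaban1987RG1, (0.4) p.253, (2.10) p.267] -/
theorem ae_forall_tstepOfRecord_eq_privateChart [DecidableEq (PBond (F.P p.K) k)] (ν : Stage7Numerics) (M : ℕ) (w : StepWeightsOfRecord F N ν M)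
    (g : ℕ → ℝ) (hk : k < p.K) (T' : SeqOfRecord F ν M g p.K k → Density (F.P p.K) k (SU N))
    (hΩm : ∀ c, MeasurableSet {q : GaugeField (F.P p.K) k (SU N) × SU N | q.2 ∈ Ω c q.1})
    (hTm : ∀ c, MeasurableSet {q : GaugeField (F.P p.K) k (SU N) × SU N | q.2 ∈ T c q.1})
    (hθm : ∀ c, Measurable fun q : GaugeField (F.P p.K) k (SU N) × SU N => ϑ c q.1 q.2)
    (hjm : ∀ c, Measurable fun q : GaugeField (F.P p.K) k (SU N) × SU N => jd c q.1 q.2)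
    (hΩbl : ∀ c (U : GaugeField (F.P p.K) k (SU N)) (g' : PBond (F.P p.K) (k + 1) → SU N), Ω c (extend centralBond g' U) = Ω c U)
    (hright : ∀ c U, ∀ v ∈ T c U, (avOfRecord F N p.K k).avg (update U (centralBond c) (ϑ c U v)) c = v)
    (hlaw : ∀ c U, (HaarData.haar : Measure (SU N)).restrict (Ω c U) =
      (((HaarData.haar : Measure (SU N)).restrict (T c U)).withDensity fun v => (jd c U v : ℝ≥0∞)).map (ϑ c U))
    (hw : ∀ s' V', Measurable fun U => w p g k s' U V') (hχ : ∀ s, Measurable (chiSeqOfRecord F N ν M g p.K k s))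
    (hT : ∀ s, Measurable (T' s)) (hwΩ : ∀ s' U V', w p g k s' U V' ≠ 0 → ∀ c, U (centralBond c) ∈ Ω c U) :
    ∀ᵐ V' ∂(fieldMeasure (F.P p.K) (k + 1) (SU N)), ∀ s' : SeqOfRecord F ν M g p.K (k + 1),
      tstepOfRecord F N ν M w p g k T' s' V' = ∫ U,
        (({q : GaugeField (F.P p.K) (k + 1) (SU N) × GaugeField (F.P p.K) k (SU N) | ∀ c, q.1 c ∈ T c q.2}.indicator
            (fun q => ∏ c, jd c q.2 (q.1 c)) (V', U) : ℝ≥0) : ℝ) *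
          (w p g k s' (extend centralBond (fun c => ϑ c U (V' c)) U) V' *
            (chiSeqOfRecord F N ν M g p.K k s'.init (extend centralBond (fun c => ϑ c U (V' c)) U) *
              T' s'.init (extend centralBond (fun c => ϑ c U (V' c)) U))) ∂(fieldMeasure (F.P p.K) k (SU N)) := by
  filter_upwards [ae_forall_tstepOfRecord_eq_chart ν M w p g hk T' (measurable_privateChart ϑ hk hθm) (measurable_privateJacobian T jd hTm hjm)
    ((measurableSet_privateDomain Ω hΩm).preimage measurable_snd) (chart_privateChart Ω T ϑ jd hk hΩm hTm hθm hjm hΩbl hright hlaw) hw hχ hT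
    (fun s' U V' hU => by
      by_contra h
      exact hU (hwΩ s' U V' h))] with V' hV' s'
  rw [hV' s']
  rfl

/-- **★★ THE REPRESENTED TOWER'S PRE-𝐑 SLOTS AT LEVEL k+1 IN THE PRIVATE-COORDINATE CHART, STAGE-13 LETTERS, EVERY HISTORY AT ONCE** (the LEFT side of N11's 𝐓-present
child obligation (O3′) «with the δ-functions removed» by resampling the central bonds): at a v1.7 parameter `θ`, `k < K`, per-bond inversion data, and the SUPPORT CLAUSE on
def-K0a's step weights of record, for `dV′`-a.e. `V′` and every length-(k+1) history `s`,
`slotsT_{k+1}(s)(V′) = ∫ dU 𝟙[∀ c, V′ c ∈ T_c(U)]·∏_c j_c(U, V′ c) · (w_k(s)(·, V′) · χ_k(init s) · slot_k(init s))(extend β (ϑ_c(U, V′ c))_c U)` — FILE 2 ★★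
`ae_forall_slotsTOfRecord₁₃H_succ_eq_chart` at §1's chart. [cite: Balaban1988Convergent, (3.1) p.264, (3.2)–(3.5) p.265, p.267 L18–24, (3.24)–(3.25) p.270; Balaban1987RG1, (2.10) p.267] -/
theorem ae_forall_slotsTOfRecord₁₃H_succ_eq_privateChart [DecidableEq (PBond (F.P p.K) k)] (θ : Stage13HParams F N) (hk : k < p.K)
    (hΩm : ∀ c, MeasurableSet {q : GaugeField (F.P p.K) k (SU N) × SU N | q.2 ∈ Ω c q.1})
    (hTm : ∀ c, MeasurableSet {q : GaugeField (F.P p.K) k (SU N) × SU N | q.2 ∈ T c q.1})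
    (hθm : ∀ c, Measurable fun q : GaugeField (F.P p.K) k (SU N) × SU N => ϑ c q.1 q.2)
    (hjm : ∀ c, Measurable fun q : GaugeField (F.P p.K) k (SU N) × SU N => jd c q.1 q.2)
    (hΩbl : ∀ c (U : GaugeField (F.P p.K) k (SU N)) (g' : PBond (F.P p.K) (k + 1) → SU N), Ω c (extend centralBond g' U) = Ω c U)
    (hright : ∀ c U, ∀ v ∈ T c U, (avOfRecord F N p.K k).avg (update U (centralBond c) (ϑ c U v)) c = v)
    (hlaw : ∀ c U, (HaarData.haar : Measure (SU N)).restrict (Ω c U) =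
      (((HaarData.haar : Measure (SU N)).restrict (T c U)).withDensity fun v => (jd c U v : ℝ≥0∞)).map (ϑ c U))
    (hw : ∀ (s : SeqOfRecord F θ.ν θ.τ9.M (gOfRecord₁₃ F N θ.toStage13Params p) p.K (k + 1)) (V' : GaugeField (F.P p.K) (k + 1) (SU N)),
      Measurable fun U => wOfRecord₉ F N θ.toStage9Params p (gOfRecord₁₃ F N θ.toStage13Params p) k s U V')
    (hχ : ∀ s₀ : SeqOfRecord F θ.ν θ.τ9.M (gOfRecord₁₃ F N θ.toStage13Params p) p.K k,
      Measurable (chiSeqOfRecord F N θ.ν θ.τ9.M (gOfRecord₁₃ F N θ.toStage13Params p) p.K k s₀))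
    (hslot : ∀ s₀ : SeqOfRecord F θ.ν θ.τ9.M (gOfRecord₁₃ F N θ.toStage13Params p) p.K k,
      Measurable (slotsOfRecord F N θ.ν θ.τ9 (EOfRecord₁₃ F N θ.toStage13Params) (wOfRecord₉ F N θ.toStage9Params) θ.ppSel p (gOfRecord₁₃ F N θ.toStage13Params p) k s₀))
    (hwΩ : ∀ (s : SeqOfRecord F θ.ν θ.τ9.M (gOfRecord₁₃ F N θ.toStage13Params p) p.K (k + 1)) (U : GaugeField (F.P p.K) k (SU N))
      (V' : GaugeField (F.P p.K) (k + 1) (SU N)),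
      wOfRecord₉ F N θ.toStage9Params p (gOfRecord₁₃ F N θ.toStage13Params p) k s U V' ≠ 0 → ∀ c, U (centralBond c) ∈ Ω c U) :
    ∀ᵐ V' ∂(fieldMeasure (F.P p.K) (k + 1) (SU N)), ∀ s : SeqOfRecord F θ.ν θ.τ9.M (gOfRecord₁₃ F N θ.toStage13Params p) p.K (k + 1),
      slotsTOfRecord F N θ.ν θ.τ9 (EOfRecord₁₃ F N θ.toStage13Params) (wOfRecord₉ F N θ.toStage9Params) θ.ppSel p (gOfRecord₁₃ F N θ.toStage13Params p) (k + 1) s V' =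
        ∫ U, (({q : GaugeField (F.P p.K) (k + 1) (SU N) × GaugeField (F.P p.K) k (SU N) | ∀ c, q.1 c ∈ T c q.2}.indicator
            (fun q => ∏ c, jd c q.2 (q.1 c)) (V', U) : ℝ≥0) : ℝ) *
          (wOfRecord₉ F N θ.toStage9Params p (gOfRecord₁₃ F N θ.toStage13Params p) k s (extend centralBond (fun c => ϑ c U (V' c)) U) V' *
            (chiSeqOfRecord F N θ.ν θ.τ9.M (gOfRecord₁₃ F N θ.toStage13Params p) p.K k s.init (extend centralBond (fun c => ϑ c U (V' c)) U) *
              slotsOfRecord F N θ.ν θ.τ9 (EOfRecord₁₃ F N θ.toStage13Params) (wOfRecord₉ F N θ.toStage9Params) θ.ppSel p (gOfRecord₁₃ F N θ.toStage13Params p) k s.init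
                (extend centralBond (fun c => ϑ c U (V' c)) U))) ∂(fieldMeasure (F.P p.K) k (SU N)) := by
  filter_upwards [ae_forall_slotsTOfRecord₁₃H_succ_eq_chart θ p hk (measurable_privateChart ϑ hk hθm) (measurable_privateJacobian T jd hTm hjm)
    ((measurableSet_privateDomain Ω hΩm).preimage measurable_snd) (chart_privateChart Ω T ϑ jd hk hΩm hTm hθm hjm hΩbl hright hlaw) hw hχ hslot
    (fun s U V' hU => by
      by_contra h
      exact hU (hwΩ s U V' h))] with V' hV' s
  rw [hV' s]
  rfl

/-- **★★ THE 𝐓-IMAGE CLAUSE IN PRIVATE-COORDINATE CURRENCY, EVERY LEVEL** (dag-n11-e's (O3′) ∕ `NoExpansionClauseFor` shape with an ARBITRARY right side `R`): under the data of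
★★ above, for every length-(k+1) history `s`,
`(slotsT_{k+1}(s) ≡ 0 ∨ a.e. on supp χ_{k+1}(s): slotsT_{k+1}(s)(V′) = R V′) ↔ (slotsT_{k+1}(s) ≡ 0 ∨ a.e. on supp χ_{k+1}(s): ∫ dU J(V′,U)·(w_k(s)·χ_k·slot_k)(Ψ(V′,U)) = R V′)` —
FILE 2 ★★ `tImageClause_iff_chart` at §1's chart. [cite: Balaban1988Convergent, (3.1) p.264, p.267 L18–24, (3.24)–(3.25) p.270, §3 p.279, Thm 2 p.263] -/
theorem tImageClause_iff_privateChart [DecidableEq (PBond (F.P p.K) k)] (θ : Stage13HParams F N) (hk : k < p.K)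
    (hΩm : ∀ c, MeasurableSet {q : GaugeField (F.P p.K) k (SU N) × SU N | q.2 ∈ Ω c q.1})
    (hTm : ∀ c, MeasurableSet {q : GaugeField (F.P p.K) k (SU N) × SU N | q.2 ∈ T c q.1})
    (hθm : ∀ c, Measurable fun q : GaugeField (F.P p.K) k (SU N) × SU N => ϑ c q.1 q.2)
    (hjm : ∀ c, Measurable fun q : GaugeField (F.P p.K) k (SU N) × SU N => jd c q.1 q.2)
    (hΩbl : ∀ c (U : GaugeField (F.P p.K) k (SU N)) (g' : PBond (F.P p.K) (k + 1) → SU N), Ω c (extend centralBond g' U) = Ω c U)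
    (hright : ∀ c U, ∀ v ∈ T c U, (avOfRecord F N p.K k).avg (update U (centralBond c) (ϑ c U v)) c = v)
    (hlaw : ∀ c U, (HaarData.haar : Measure (SU N)).restrict (Ω c U) =
      (((HaarData.haar : Measure (SU N)).restrict (T c U)).withDensity fun v => (jd c U v : ℝ≥0∞)).map (ϑ c U))
    (hw : ∀ (s : SeqOfRecord F θ.ν θ.τ9.M (gOfRecord₁₃ F N θ.toStage13Params p) p.K (k + 1)) (V' : GaugeField (F.P p.K) (k + 1) (SU N)),
      Measurable fun U => wOfRecord₉ F N θ.toStage9Params p (gOfRecord₁₃ F N θ.toStage13Params p) k s U V')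
    (hχ : ∀ s₀ : SeqOfRecord F θ.ν θ.τ9.M (gOfRecord₁₃ F N θ.toStage13Params p) p.K k,
      Measurable (chiSeqOfRecord F N θ.ν θ.τ9.M (gOfRecord₁₃ F N θ.toStage13Params p) p.K k s₀))
    (hslot : ∀ s₀ : SeqOfRecord F θ.ν θ.τ9.M (gOfRecord₁₃ F N θ.toStage13Params p) p.K k,
      Measurable (slotsOfRecord F N θ.ν θ.τ9 (EOfRecord₁₃ F N θ.toStage13Params) (wOfRecord₉ F N θ.toStage9Params) θ.ppSel p (gOfRecord₁₃ F N θ.toStage13Params p) k s₀))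
    (hwΩ : ∀ (s : SeqOfRecord F θ.ν θ.τ9.M (gOfRecord₁₃ F N θ.toStage13Params p) p.K (k + 1)) (U : GaugeField (F.P p.K) k (SU N))
      (V' : GaugeField (F.P p.K) (k + 1) (SU N)),
      wOfRecord₉ F N θ.toStage9Params p (gOfRecord₁₃ F N θ.toStage13Params p) k s U V' ≠ 0 → ∀ c, U (centralBond c) ∈ Ω c U)
    (s : SeqOfRecord F θ.ν θ.τ9.M (gOfRecord₁₃ F N θ.toStage13Params p) p.K (k + 1)) (R : GaugeField (F.P p.K) (k + 1) (SU N) → ℝ) :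
    (slotsTOfRecord F N θ.ν θ.τ9 (EOfRecord₁₃ F N θ.toStage13Params) (wOfRecord₉ F N θ.toStage9Params) θ.ppSel p (gOfRecord₁₃ F N θ.toStage13Params p) (k + 1) s = 0 ∨
      ∀ᵐ V' ∂fieldMeasure (F.P p.K) (k + 1) (SU N),
        chiSeqOfRecord F N θ.ν θ.τ9.M (gOfRecord₁₃ F N θ.toStage13Params p) p.K (k + 1) s V' ≠ 0 →
          slotsTOfRecord F N θ.ν θ.τ9 (EOfRecord₁₃ F N θ.toStage13Params) (wOfRecord₉ F N θ.toStage9Params) θ.ppSel p (gOfRecord₁₃ F N θ.toStage13Params p) (k + 1) s V' =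
            R V') ↔
    (slotsTOfRecord F N θ.ν θ.τ9 (EOfRecord₁₃ F N θ.toStage13Params) (wOfRecord₉ F N θ.toStage9Params) θ.ppSel p (gOfRecord₁₃ F N θ.toStage13Params p) (k + 1) s = 0 ∨
      ∀ᵐ V' ∂fieldMeasure (F.P p.K) (k + 1) (SU N),
        chiSeqOfRecord F N θ.ν θ.τ9.M (gOfRecord₁₃ F N θ.toStage13Params p) p.K (k + 1) s V' ≠ 0 →
          ∫ U, (({q : GaugeField (F.P p.K) (k + 1) (SU N) × GaugeField (F.P p.K) k (SU N) | ∀ c, q.1 c ∈ T c q.2}.indicator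
              (fun q => ∏ c, jd c q.2 (q.1 c)) (V', U) : ℝ≥0) : ℝ) *
            (wOfRecord₉ F N θ.toStage9Params p (gOfRecord₁₃ F N θ.toStage13Params p) k s (extend centralBond (fun c => ϑ c U (V' c)) U) V' *
              (chiSeqOfRecord F N θ.ν θ.τ9.M (gOfRecord₁₃ F N θ.toStage13Params p) p.K k s.init (extend centralBond (fun c => ϑ c U (V' c)) U) *
                slotsOfRecord F N θ.ν θ.τ9 (EOfRecord₁₃ F N θ.toStage13Params) (wOfRecord₉ F N θ.toStage9Params) θ.ppSel p (gOfRecord₁₃ F N θ.toStage13Params p) k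
                  s.init (extend centralBond (fun c => ϑ c U (V' c)) U))) ∂(fieldMeasure (F.P p.K) k (SU N)) = R V') := by
  refine or_congr_right (Filter.eventually_congr ?_)
  filter_upwards [ae_forall_slotsTOfRecord₁₃H_succ_eq_privateChart p Ω T ϑ jd θ hk hΩm hTm hθm hjm hΩbl hright hlaw hw hχ hslot hwΩ] with V' hV'
  rw [hV' s]

end TStep

/-! ## §4  The FIRST renormalization step (`k = 0 < K`) in private-coordinate currency -/

section FirstStep

open scoped Matrix.Norms.L2Operator
open Node00 hiding SU
open T4Continuum Node00.Tk Step
open BalabanUVNodesN11FirstStepSupply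

variable {F : T4Family} {N : ℕ} [NeZero N] (p : B12.RunParams)
  (Ω T : PBond (F.P p.K) (0 + 1) → GaugeField (F.P p.K) 0 (SU N) → Set (SU N))
  (ϑ : PBond (F.P p.K) (0 + 1) → GaugeField (F.P p.K) 0 (SU N) → SU N → SU N)
  (jd : PBond (F.P p.K) (0 + 1) → GaugeField (F.P p.K) 0 (SU N) → SU N → ℝ≥0)

/-- **★★ THE PRE-𝐑 SLOTS OF `𝐓ρ₀` IN THE PRIVATE-COORDINATE CHART, EVERY LENGTH-1 HISTORY AT ONCE**: at a v1.7 parameter `θ`, `0 < K`, per-bond inversion data at level 0 and the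
SUPPORT CLAUSE on the level-0 step weights: for `dV′`-a.e. `V′` and every `s`,
`slotsT₁(s)(V′) = ∫ dU 𝟙[∀ c, V′ c ∈ T_c(U)]·∏_c j_c(U, V′ c) · w₀(s)(Ψ(V′,U), V′) · ρ₀(Ψ(V′,U))` (`Ψ(V′,U) = extend β (ϑ_c(U, V′ c))_c U`) — FILE 2 ★★
`ae_forall_slotsTOfRecord₁₃H_one_eq_chart` at §1's chart. [cite: Balaban1988Convergent, Thm 1 p.262, (3.1) p.264, (3.2)–(3.5) p.265, p.267 L18–24, (3.24)–(3.25) p.270] -/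
theorem ae_forall_slotsTOfRecord₁₃H_one_eq_privateChart [DecidableEq (PBond (F.P p.K) 0)] (θ : Stage13HParams F N) (hK : 0 < p.K)
    (hΩm : ∀ c, MeasurableSet {q : GaugeField (F.P p.K) 0 (SU N) × SU N | q.2 ∈ Ω c q.1})
    (hTm : ∀ c, MeasurableSet {q : GaugeField (F.P p.K) 0 (SU N) × SU N | q.2 ∈ T c q.1})
    (hθm : ∀ c, Measurable fun q : GaugeField (F.P p.K) 0 (SU N) × SU N => ϑ c q.1 q.2)
    (hjm : ∀ c, Measurable fun q : GaugeField (F.P p.K) 0 (SU N) × SU N => jd c q.1 q.2)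
    (hΩbl : ∀ c (U : GaugeField (F.P p.K) 0 (SU N)) (g' : PBond (F.P p.K) (0 + 1) → SU N), Ω c (extend centralBond g' U) = Ω c U)
    (hright : ∀ c U, ∀ v ∈ T c U, (avOfRecord F N p.K 0).avg (update U (centralBond c) (ϑ c U v)) c = v)
    (hlaw : ∀ c U, (HaarData.haar : Measure (SU N)).restrict (Ω c U) =
      (((HaarData.haar : Measure (SU N)).restrict (T c U)).withDensity fun v => (jd c U v : ℝ≥0∞)).map (ϑ c U))
    (hw : ∀ (s : SeqOfRecord F θ.ν θ.τ9.M (gOfRecord₁₃ F N θ.toStage13Params p) p.K 1) (V' : GaugeField (F.P p.K) 1 (SU N)),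
      Measurable fun U => wOfRecord₉ F N θ.toStage9Params p (gOfRecord₁₃ F N θ.toStage13Params p) 0 s U V')
    (hwΩ : ∀ (s : SeqOfRecord F θ.ν θ.τ9.M (gOfRecord₁₃ F N θ.toStage13Params p) p.K 1) (U : GaugeField (F.P p.K) 0 (SU N)) (V' : GaugeField (F.P p.K) 1 (SU N)),
      wOfRecord₉ F N θ.toStage9Params p (gOfRecord₁₃ F N θ.toStage13Params p) 0 s U V' ≠ 0 → ∀ c, U (centralBond c) ∈ Ω c U) :
    ∀ᵐ V' ∂(fieldMeasure (F.P p.K) 1 (SU N)), ∀ s : SeqOfRecord F θ.ν θ.τ9.M (gOfRecord₁₃ F N θ.toStage13Params p) p.K 1,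
      slotsTOfRecord F N θ.ν θ.τ9 (EOfRecord₁₃ F N θ.toStage13Params) (wOfRecord₉ F N θ.toStage9Params) θ.ppSel p (gOfRecord₁₃ F N θ.toStage13Params p) 1 s V' =
        ∫ U, (({q : GaugeField (F.P p.K) (0 + 1) (SU N) × GaugeField (F.P p.K) 0 (SU N) | ∀ c, q.1 c ∈ T c q.2}.indicator
            (fun q => ∏ c, jd c q.2 (q.1 c)) (V', U) : ℝ≥0) : ℝ) *
          (wOfRecord₉ F N θ.toStage9Params p (gOfRecord₁₃ F N θ.toStage13Params p) 0 s (extend centralBond (fun c => ϑ c U (V' c)) U) V' *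
            rhoZeroOfRecord F N p.K (gOfRecord₁₃ F N θ.toStage13Params p 0) (EOfRecord₁₃ F N θ.toStage13Params p)
              (extend centralBond (fun c => ϑ c U (V' c)) U)) ∂(fieldMeasure (F.P p.K) 0 (SU N)) := by
  filter_upwards [ae_forall_slotsTOfRecord₁₃H_one_eq_chart θ p hK (measurable_privateChart ϑ hK hθm) (measurable_privateJacobian T jd hTm hjm)
    ((measurableSet_privateDomain Ω hΩm).preimage measurable_snd) (chart_privateChart Ω T ϑ jd hK hΩm hTm hθm hjm hΩbl hright hlaw) hw
    (fun s U V' hU => by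
      by_contra h
      exact hU (hwΩ s U V' h))] with V' hV' s
  rw [hV' s]
  rfl

/-- **★★★ THE FIRST RENORMALIZATION STEP IN PRIVATE-COORDINATE CURRENCY**: under the level-0 data of ★★ above, this seat's `FirstStepIntegralIdentityAt θ p`
(`↔ FirstStepSupplyAt θ p ↔` dag-n11-e's `Sect3SpliceSupplyAt θ p 0`; g0 p588912) is EQUIVALENT to the same predicate with the 𝐓-image clause (iii′) written as an honest
`dU`-integral over resampled central bonds: EITHER `slotsT₁(s) ≡ 0`, OR for `dV′`-a.e. `V′` on the support of `χ₁(s)`,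
`∫ dU 𝟙[∀ c, V′ c ∈ T_c(U)]·∏_c j_c(U, V′ c) · w₀(s)(Ψ(V′,U), V′) · ρ₀(Ψ(V′,U)) = 𝐓₁(s)[W(s)] (exp A₁(s)[u s, E₁ s]) (V′)` — [I] Thm 1's first step `𝐓ρ₀ = 𝐓₁ exp A₁` with the
δ-functions removed by SOLVING `Ū′(c) = V′(c)` for the central bond variables (per-bond inversions DISPLAYED).  FILE 2 ★★★ `firstStepIntegralIdentityAt_iff_chart` at §1's chart;
`.mpr` followed by g0's `sLaw₁₃CoPH_one_rePinH_doorCured_theta13LiveOfRecord_of_integralIdentity` gives `ρ₁`'s §2 form at the re-pinned door.  A predicate-level equivalence —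
NOT claimed inhabited for any `θ`. [cite: Balaban1987RG1, Thm 1 p.259, (0.24)–(0.27) p.257, (2.10) p.267; Balaban1988Convergent, Thm 1 p.262, (3.1) p.264, (3.24)–(3.25) p.270, p.267 L18–24] -/
theorem firstStepIntegralIdentityAt_iff_privateChart [DecidableEq (PBond (F.P p.K) 0)] (θ : Stage13HParams F N) (hK : 0 < p.K)
    (hΩm : ∀ c, MeasurableSet {q : GaugeField (F.P p.K) 0 (SU N) × SU N | q.2 ∈ Ω c q.1})
    (hTm : ∀ c, MeasurableSet {q : GaugeField (F.P p.K) 0 (SU N) × SU N | q.2 ∈ T c q.1})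
    (hθm : ∀ c, Measurable fun q : GaugeField (F.P p.K) 0 (SU N) × SU N => ϑ c q.1 q.2)
    (hjm : ∀ c, Measurable fun q : GaugeField (F.P p.K) 0 (SU N) × SU N => jd c q.1 q.2)
    (hΩbl : ∀ c (U : GaugeField (F.P p.K) 0 (SU N)) (g' : PBond (F.P p.K) (0 + 1) → SU N), Ω c (extend centralBond g' U) = Ω c U)
    (hright : ∀ c U, ∀ v ∈ T c U, (avOfRecord F N p.K 0).avg (update U (centralBond c) (ϑ c U v)) c = v)
    (hlaw : ∀ c U, (HaarData.haar : Measure (SU N)).restrict (Ω c U) =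
      (((HaarData.haar : Measure (SU N)).restrict (T c U)).withDensity fun v => (jd c U v : ℝ≥0∞)).map (ϑ c U))
    (hw : ∀ (s : SeqOfRecord F θ.ν θ.τ9.M (gOfRecord₁₃ F N θ.toStage13Params p) p.K 1) (V' : GaugeField (F.P p.K) 1 (SU N)),
      Measurable fun U => wOfRecord₉ F N θ.toStage9Params p (gOfRecord₁₃ F N θ.toStage13Params p) 0 s U V')
    (hwΩ : ∀ (s : SeqOfRecord F θ.ν θ.τ9.M (gOfRecord₁₃ F N θ.toStage13Params p) p.K 1) (U : GaugeField (F.P p.K) 0 (SU N)) (V' : GaugeField (F.P p.K) 1 (SU N)),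
      wOfRecord₉ F N θ.toStage9Params p (gOfRecord₁₃ F N θ.toStage13Params p) 0 s U V' ≠ 0 → ∀ c, U (centralBond c) ∈ Ω c U) :
    FirstStepIntegralIdentityAt θ p ↔
    ∃ (u : SeqOfRecord F θ.ν θ.τ9.M (gOfRecord₁₃ F N θ.toStage13Params p) p.K 1 → Sect2.TermValues (F.P p.K) (MatA N) (FluctV N) θ.τ9.M)
      (E₁ : SeqOfRecord F θ.ν θ.τ9.M (gOfRecord₁₃ F N θ.toStage13Params p) p.K 1 → ℝ),
      Sect2.UniversalE u ∧
      ∀ s : SeqOfRecord F θ.ν θ.τ9.M (gOfRecord₁₃ F N θ.toStage13Params p) p.K 1, s.Ω 1 ≠ ∅ →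
        Step.LFNewTerms (sect2TowerOfRecord F N (FluctV N) p.K (settingOfRecord₁₃ F N θ.toStage13Params p) (θ.rzAt p s) s (u s))
          (settingOfRecord₁₃ F N θ.toStage13Params p).lf (settingOfRecord₁₃ F N θ.toStage13Params p).βc 0 ∧
        (∀ (X : (Sect2.domSys (F.P p.K) θ.τ9.M 1).Dom) (z : Site (F.P p.K) 1) (g : ℝ), 0 ≤ g → g ≤ (settingOfRecord₁₃ F N θ.toStage13Params p).lf.γ →
          AnalyticOnNhd ℂ ((u s).E 1 X z g)
            ((sect2TowerOfRecord F N (FluctV N) p.K (settingOfRecord₁₃ F N θ.toStage13Params p) (θ.rzAt p s) s (u s)).space 1 X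
              ((settingOfRecord₁₃ F N θ.toStage13Params p).lf.alpha0 ((settingOfRecord₁₃ F N θ.toStage13Params p).flow.g 1))
              ((settingOfRecord₁₃ F N θ.toStage13Params p).lf.alpha1 ((settingOfRecord₁₃ F N θ.toStage13Params p).flow.g 1)))) ∧
        (∀ X : (Sect2.domSys (F.P p.K) θ.τ9.M 1).Dom,
          AnalyticOnNhd ℂ ((u s).R 1 X)
            ((sect2TowerOfRecord F N (FluctV N) p.K (settingOfRecord₁₃ F N θ.toStage13Params p) (θ.rzAt p s) s (u s)).space 1 X
              ((settingOfRecord₁₃ F N θ.toStage13Params p).lf.alpha0 ((settingOfRecord₁₃ F N θ.toStage13Params p).flow.g 1))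
              ((settingOfRecord₁₃ F N θ.toStage13Params p).lf.alpha1 ((settingOfRecord₁₃ F N θ.toStage13Params p).flow.g 1)))) ∧
        (∀ (X : (Sect2.domSys (F.P p.K) θ.τ9.M 1).Dom) (a : SFluct (F.P p.K) (FluctV N)),
          AnalyticOnNhd ℂ (fun φ => (u s).B 1 X φ a)
            ((sect2TowerOfRecord F N (FluctV N) p.K (settingOfRecord₁₃ F N θ.toStage13Params p) (θ.rzAt p s) s (u s)).spaceB 1 X)) ∧
        -- (iii‴) the 𝐓-image identity of the first step IN THE PRIVATE-COORDINATE CHART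
        (slotsTOfRecord F N θ.ν θ.τ9 (EOfRecord₁₃ F N θ.toStage13Params) (wOfRecord₉ F N θ.toStage9Params) θ.ppSel p
            (gOfRecord₁₃ F N θ.toStage13Params p) 1 s = 0 ∨
          ∀ᵐ V' ∂fieldMeasure (F.P p.K) 1 (SU N),
            chiSeqOfRecord F N θ.ν θ.τ9.M (gOfRecord₁₃ F N θ.toStage13Params p) p.K 1 s V' ≠ 0 →
              ∫ U, (({q : GaugeField (F.P p.K) (0 + 1) (SU N) × GaugeField (F.P p.K) 0 (SU N) | ∀ c, q.1 c ∈ T c q.2}.indicator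
                  (fun q => ∏ c, jd c q.2 (q.1 c)) (V', U) : ℝ≥0) : ℝ) *
                (wOfRecord₉ F N θ.toStage9Params p (gOfRecord₁₃ F N θ.toStage13Params p) 0 s (extend centralBond (fun c => ϑ c U (V' c)) U) V' *
                  rhoZeroOfRecord F N p.K (gOfRecord₁₃ F N θ.toStage13Params p 0) (EOfRecord₁₃ F N θ.toStage13Params p)
                    (extend centralBond (fun c => ϑ c U (V' c)) U)) ∂(fieldMeasure (F.P p.K) 0 (SU N)) =
                TkOfRecord F N (FluctV N) θ.ν θ.τ9.M (gOfRecord₁₃ F N θ.toStage13Params p) p.K (WtOfRecord₁₃H F N θ p s) 1 s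
                  (sect2Operand F N (FluctV N) p.K (settingOfRecord₁₃ F N θ.toStage13Params p) (θ.rzAt p s) s (u s) (E₁ s)
                    (UbgOfRecord₁₃CoP F N θ.toStage13Params p 1 s)) V') :=
  firstStepIntegralIdentityAt_iff_chart θ p hK (measurable_privateChart ϑ hK hθm) (measurable_privateJacobian T jd hTm hjm)
    ((measurableSet_privateDomain Ω hΩm).preimage measurable_snd) (chart_privateChart Ω T ϑ jd hK hΩm hTm hθm hjm hΩbl hright hlaw) hw
    (fun s U V' hU => by
      by_contra h
      exact hU (hwΩ s U V' h))

end FirstStep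

end Summit.QuantumFields.YangMills.Theorems.BalabanUVNodesN11TStepInPrivateCoordinateChart

end
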